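import Summits.ResolutionOfSingularities.ResolutionOfSingularities.Theorems.WeightedInvariantE2CoreInvariance
import Summits.ResolutionOfSingularities.ResolutionOfSingularities.Theorems.WeightedInvariantE2HomogeneousChartDefs
import Summits.ResolutionOfSingularities.ResolutionOfSingularities.Theorems.WeightedInvariantHypersurfaceLocalGameEFT4SDimLEDoorGradedHom
import Literature.AlgebraicGeometry.Resolution.CotangentIndependenceSpread
import HarnessLib

/-!
# E2 centre, ring-level hand: (G-0-abc)(+d) — THE HOMOGENEOUS CHART FROM A HOMOGENEOUS-PARAMETER PRESENTATION
# `LocalEngine.e2HomChartOfHomU : PRungGrHomLE 3 p ι J → E2HomChartOfHomUBody p ι J`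

[OURS · L1 W4.3 · DOOR `HypersurfaceCentreConstruction` stmt-ResolutionOfSingularities-19897 · E2 tier, centre piece (C-c)
`E2CentreGlueBody`; registrar res-L1-w43-plan-1 SPEC (Δ11) rev 9 (`…E2HomogeneousChartDefs`: `JOpenBodyLE3HomU`, `JOpenBodyLE3Hom`,
`E2HomChartOfHomUBody`), RULING (G-0) 2026-08-27T19:33:51Z / 19:36:56Z; hand res-L1-s36-pv-1.  Candidate-design support on OUR clause
vocabulary; nothing here is a statement of, or about, the manuscript under adjudication (Hironaka 2017); AI-written, weaker than expert review.]

## Statement and proof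

At a homogeneous prime `𝔪` (graded finite-type algebra `A` over a perfect field, `𝒜 : (Fin j → ℤ) → AddSubgroup A`, `A_𝔪` regular of
dimension `≤ 3`, `F` homogeneous), an (open″)≤3 presentation `(h₀; U, W)` with HOMOGENEOUS parameters `Uᵢ` (`JOpenBodyLE3HomU`) is improved to one
with the SAME `U, W`, a HOMOGENEOUS localising element `h`, and the (reg) clause «`A_𝔮` regular-and-`U` cotangent-independent at every prime
`𝔮 ⊇ (U)` of `D(h)`» (`JOpenBodyLE3Hom`):

1. SPREAD (tree `CotangentIndependenceSpread.exists_notMem_forall_linearIndependent_toCotangent`, perfect ground field): some `f₁ ∉ 𝔪` makes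
   `U` cotangent-independent in the regular `A_𝔮` at every `𝔮 ⊇ (U)` of `D(f₁)`, and (empty family) some `f₀ ∉ 𝔪` makes `A_𝔮` regular on `D(f₀)`;
2. the set `Bad` of primes `𝔮` at which «`A_𝔮` regular ∧ (dim ≤ 3 ⇒ iff/J-clauses) ∧ (`U ⊆ 𝔮` ⇒ cotangent-independent)» FAILS lies in
   `V(h₀ f₀ f₁)` and is CORE-STABLE (`good_of_good_homogeneousCore`: every conjunct transfers from the homogeneous core `𝔮*` up to `𝔮` by the
   generic-translate square of `…E2CoreInvariance` — regularity, `ι`, `𝔪²`-membership, the `J`-clause for homogeneous `U`, cotangent classes);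
3. the HOMOGENEOUS SHRINK `E2Model.exists_decompose_not_mem_forall_mem` (…E2HomogeneousShrink) yields a homogeneous component `h` of `h₀ f₀ f₁`
   with `h ∉ 𝔪` and `Bad ⊆ V(h)`.

Rung inputs: (c11)≤3 `IotaJEssSmoothCompatibleLE 3 ι J` (`hr.1.2.2.2.2.2.1`), `IotaUnitInvariant` / `JUnitInvariant` (`hr.1.2.2.2.2.2.2.2.2`);
nothing else of the rung is used (in particular not (open″) itself: the presentation is the hypothesis `JOpenBodyLE3HomU`).
-/

set_option linter.dupNamespace false

noncomputable section

open IsLocalRing SetLike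
open Literature.AlgebraicGeometry.Resolution
open Summit.ResolutionOfSingularities.ResolutionOfSingularities.Theorems

namespace Summit.ResolutionOfSingularities.ResolutionOfSingularities.Cruxes.HypersurfaceCentreConstruction.LocalEngine

namespace E2Model

variable {j : ℕ} {A : Type} [CommRing A] [IsNoetherianRing A] (𝒜 : (Fin j → ℤ) → AddSubgroup A) [GradedRing 𝒜]
  {ι : (R : Type) → [CommRing R] → R → Ordinal.{0}} {J : (R : Type) → [CommRing R] → R → ℕ → Ideal R}

/-- **CORE STEP (G-0 (b)+(c)+(d) at one prime).**  The conjunction «`A_𝔮` regular ∧ (`dim A_𝔮 ≤ 3` ⇒ the (iff)- and (J)-clauses of the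
presentation `(U, W)` at `𝔮`) ∧ (`U ⊆ 𝔮` ⇒ `U` cotangent-independent in `A_𝔮`)» TRANSFERS from the homogeneous core `𝔮*` UP to `𝔮`, for
homogeneous `F` and homogeneous parameters `Uᵢ` (all transfers by `…E2CoreInvariance`; the dimension guard descends since `𝔮* ≤ 𝔮`).
[OURS · (G-0-abc)(+d) core step] -/
theorem good_of_good_homogeneousCore (hc11 : IotaJEssSmoothCompatibleLE 3 ι J) (hIunit : IotaUnitInvariant ι)
    (hJunit : JUnitInvariant J) {F : A} (hF : IsHomogeneousElem 𝒜 F) {N : ℕ} (U : Fin N → A) (W : Fin N → ℕ)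
    (hU : ∀ i, IsHomogeneousElem 𝒜 (U i)) (𝔪 : Ideal A) [𝔪.IsPrime]
    (𝔮 : Ideal A) [𝔮.IsPrime] (𝔮' : Ideal A) [𝔮'.IsPrime] (h𝔮' : 𝔮' = (𝔮.homogeneousCore 𝒜).toIdeal)
    (hgood' : IsRegularLocalRing (Localization.AtPrime 𝔮') ∧
      (ringKrullDim (Localization.AtPrime 𝔮') ≤ (3 : ℕ) →
        ((∀ i, U i ∈ 𝔮') ↔
          (algebraMap A (Localization.AtPrime 𝔮') F ∈ (maximalIdeal (Localization.AtPrime 𝔮')) ^ 2 ∧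
            ι (Localization.AtPrime 𝔮') (algebraMap A (Localization.AtPrime 𝔮') F) =
              ι (Localization.AtPrime 𝔪) (algebraMap A (Localization.AtPrime 𝔪) F))) ∧
        ((∀ i, U i ∈ 𝔮') → ∀ m : ℕ,
          J (Localization.AtPrime 𝔮') (algebraMap A (Localization.AtPrime 𝔮') F) m =
            (weightedMonomialIdeal U W m).map (algebraMap A (Localization.AtPrime 𝔮')))) ∧
      ((∀ i, U i ∈ 𝔮') →
        ∃ hU𝔮 : ∀ i, algebraMap A (Localization.AtPrime 𝔮') (U i) ∈ maximalIdeal (Localization.AtPrime 𝔮'),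
          LinearIndependent (ResidueField (Localization.AtPrime 𝔮'))
            (fun i => ((maximalIdeal (Localization.AtPrime 𝔮')).toCotangent ⟨_, hU𝔮 i⟩ :
              CotangentSpace (Localization.AtPrime 𝔮'))))) :
    IsRegularLocalRing (Localization.AtPrime 𝔮) ∧
      (ringKrullDim (Localization.AtPrime 𝔮) ≤ (3 : ℕ) →
        ((∀ i, U i ∈ 𝔮) ↔
          (algebraMap A (Localization.AtPrime 𝔮) F ∈ (maximalIdeal (Localization.AtPrime 𝔮)) ^ 2 ∧
            ι (Localization.AtPrime 𝔮) (algebraMap A (Localization.AtPrime 𝔮) F) =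
              ι (Localization.AtPrime 𝔪) (algebraMap A (Localization.AtPrime 𝔪) F))) ∧
        ((∀ i, U i ∈ 𝔮) → ∀ m : ℕ,
          J (Localization.AtPrime 𝔮) (algebraMap A (Localization.AtPrime 𝔮) F) m =
            (weightedMonomialIdeal U W m).map (algebraMap A (Localization.AtPrime 𝔮)))) ∧
      ((∀ i, U i ∈ 𝔮) →
        ∃ hU𝔮 : ∀ i, algebraMap A (Localization.AtPrime 𝔮) (U i) ∈ maximalIdeal (Localization.AtPrime 𝔮),
          LinearIndependent (ResidueField (Localization.AtPrime 𝔮))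
            (fun i => ((maximalIdeal (Localization.AtPrime 𝔮)).toCotangent ⟨_, hU𝔮 i⟩ :
              CotangentSpace (Localization.AtPrime 𝔮)))) := by
  obtain ⟨hreg', hcl', hind'⟩ := hgood'
  haveI := hreg'
  haveI hreg : IsRegularLocalRing (Localization.AtPrime 𝔮) :=
    isRegularLocalRing_localization_of_homogeneousCore 𝒜 𝔮 𝔮' h𝔮'
  -- `U ⊆ 𝔮 ↔ U ⊆ 𝔮*` by homogeneity of the `U i`
  have hUcore : (∀ i, U i ∈ 𝔮) ↔ (∀ i, U i ∈ 𝔮') := by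
    constructor
    · intro h i
      rw [h𝔮']
      exact Ideal.mem_homogeneousCore_of_homogeneous_of_mem (hU i) (h i)
    · intro h i
      exact Ideal.toIdeal_homogeneousCore_le 𝒜 𝔮 (h𝔮' ▸ h i)
  refine ⟨hreg, fun hd => ?_, fun hUq => ?_⟩
  · have hd' : ringKrullDim (Localization.AtPrime 𝔮') ≤ (3 : ℕ) :=
      (ringKrullDim_localization_homogeneousCore_le 𝒜 𝔮 𝔮' h𝔮').trans hd
    obtain ⟨hiff', hJ'⟩ := hcl' hd'
    have hsq := mem_pow_maximalIdeal_localization_homogeneousCore_iff 𝒜 𝔮 𝔮' h𝔮' hF 2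
    have hι := iota_localization_homogeneousCore_eq 𝒜 𝔮 𝔮' h𝔮' hc11 hIunit hd hF
    refine ⟨?_, fun hUq m => ?_⟩
    · rw [hUcore, hiff', hsq, hι]
    · exact jeq_localization_of_jeq_homogeneousCore 𝒜 𝔮 𝔮' h𝔮' hc11 hJunit hd hF U W hU (hJ' (hUcore.mp hUq)) m
  · obtain ⟨hU', hli'⟩ := hind' (hUcore.mp hUq)
    have hU𝔮 : ∀ i, algebraMap A (Localization.AtPrime 𝔮) (U i) ∈ maximalIdeal (Localization.AtPrime 𝔮) :=
      fun i => (IsLocalization.AtPrime.to_map_mem_maximal_iff (Localization.AtPrime 𝔮) 𝔮 (U i)).mpr (hUq i)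
    exact ⟨hU𝔮, linearIndependent_toCotangent_localization_of_homogeneousCore 𝒜 𝔮 𝔮' h𝔮' U hU hU' hli' hU𝔮⟩

end E2Model

/-! ## The closer -/

open E2Model in
/-- **(G-0-abc)(+d): `PRungGrHomLE 3 p ι J → E2HomChartOfHomUBody p ι J`** — at every graded orbit-generic position, an (open″)≤3
presentation with homogeneous parameters (`JOpenBodyLE3HomU`) yields one with the SAME parameters, a HOMOGENEOUS localising element and the
(reg) clause (`JOpenBodyLE3Hom`).  Spread (perfect ground field) + core-stability of the failure set (generic-translate square) + homogeneous
shrink. [OURS · registrar SPEC (Δ11) rev 9 target of board item (o47-c-ring) (G-0-abc); hand res-L1-s36-pv-1] -/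
theorem e2HomChartOfHomU (p : ℕ) (hp : p.Prime) (ι : (R : Type) → [CommRing R] → R → Ordinal.{0})
    (J : (R : Type) → [CommRing R] → R → ℕ → Ideal R) : PRungGrHomLE 3 p ι J → E2HomChartOfHomUBody p ι J := by
  intro hr k₀ _ _ _ A _ _ _ j 𝒜 _ h0 𝔪 _ F h𝔪 hgs hF hreg hdim hF0 hF2 hHomU
  classical
  have _ := hp
  have _ := h0
  have _ := hgs
  have _ := hdim
  have _ := hF0
  have _ := hF2
  haveI : IsNoetherianRing A := Algebra.FiniteType.isNoetherianRing k₀ A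
  haveI := hreg
  have hc11 : IotaJEssSmoothCompatibleLE 3 ι J := hr.1.2.2.2.2.2.1
  have hIunit : IotaUnitInvariant ι := hr.1.2.2.2.2.2.2.2.2.1
  have hJunit : JUnitInvariant J := hr.1.2.2.2.2.2.2.2.2.2
  obtain ⟨h₀, hh₀, N, U, W, hW, hUhom, ⟨hU𝔪, hli𝔪⟩, hcl⟩ := hHomU
  -- (1) spread: cotangent independence and regularity along `V(U)` near `𝔪`, and regularity near `𝔪`
  obtain ⟨f₁, hf₁, hsp₁⟩ := exists_notMem_forall_linearIndependent_toCotangent k₀ 𝔪 U hU𝔪 hli𝔪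
  obtain ⟨f₀, hf₀, hsp₀⟩ := exists_notMem_forall_linearIndependent_toCotangent k₀ 𝔪 (fun i : Fin 0 => (0 : A))
    (fun i => i.elim0) (linearIndependent_empty_type)
  -- (2) the good-prime predicate and its failure set
  let Good : ∀ (I : Ideal A), I.IsPrime → Prop := fun I _ =>
    IsRegularLocalRing (Localization.AtPrime I) ∧
      (ringKrullDim (Localization.AtPrime I) ≤ (3 : ℕ) →
        ((∀ i, U i ∈ I) ↔
          (algebraMap A (Localization.AtPrime I) F ∈ (maximalIdeal (Localization.AtPrime I)) ^ 2 ∧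
            ι (Localization.AtPrime I) (algebraMap A (Localization.AtPrime I) F) =
              ι (Localization.AtPrime 𝔪) (algebraMap A (Localization.AtPrime 𝔪) F))) ∧
        ((∀ i, U i ∈ I) → ∀ m : ℕ,
          J (Localization.AtPrime I) (algebraMap A (Localization.AtPrime I) F) m =
            (weightedMonomialIdeal U W m).map (algebraMap A (Localization.AtPrime I)))) ∧
      ((∀ i, U i ∈ I) →
        ∃ hU𝔮 : ∀ i, algebraMap A (Localization.AtPrime I) (U i) ∈ maximalIdeal (Localization.AtPrime I),
          LinearIndependent (ResidueField (Localization.AtPrime I))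
            (fun i => ((maximalIdeal (Localization.AtPrime I)).toCotangent ⟨_, hU𝔮 i⟩ :
              CotangentSpace (Localization.AtPrime I))))
  have hgood : ∀ (𝔮 : Ideal A) (h𝔮 : 𝔮.IsPrime), h₀ * f₀ * f₁ ∉ 𝔮 → Good 𝔮 h𝔮 := by
    intro 𝔮 h𝔮 hg
    have hh₀𝔮 : h₀ ∉ 𝔮 := fun h => hg (𝔮.mul_mem_right _ (𝔮.mul_mem_right _ h))
    have hf₀𝔮 : f₀ ∉ 𝔮 := fun h => hg (𝔮.mul_mem_right _ (𝔮.mul_mem_left _ h))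
    have hf₁𝔮 : f₁ ∉ 𝔮 := fun h => hg (𝔮.mul_mem_left _ h)
    refine ⟨(hsp₀ 𝔮 hf₀𝔮 (fun i => i.elim0)).1, fun hd => hcl 𝔮 hh₀𝔮 hd, fun hUq => (hsp₁ 𝔮 hf₁𝔮 hUq).2⟩
  set Bad : Set (Ideal A) := {I | ∃ hI : I.IsPrime, ¬ Good I hI} with hBad_def
  have hBad : ∀ I ∈ Bad, h₀ * f₀ * f₁ ∈ I := by
    rintro I ⟨hI, hbad⟩
    by_contra hg
    exact hbad (hgood I hI hg)
  have hcore : ∀ I ∈ Bad, (I.homogeneousCore 𝒜).toIdeal ∈ Bad := by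
    rintro I ⟨hI, hbad⟩
    haveI := hI
    haveI hI' : (I.homogeneousCore 𝒜).toIdeal.IsPrime := isPrime_homogeneousCore 𝒜 hI
    refine ⟨hI', fun hgood' => hbad ?_⟩
    exact good_of_good_homogeneousCore 𝒜 hc11 hIunit hJunit hF U W hUhom 𝔪 I (I.homogeneousCore 𝒜).toIdeal rfl hgood'
  -- (3) the homogeneous shrink
  have hg𝔪 : h₀ * f₀ * f₁ ∉ 𝔪 := by
    intro h
    rcases ‹𝔪.IsPrime›.mem_or_mem h with h | h
    · rcases ‹𝔪.IsPrime›.mem_or_mem h with h | h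
      · exact hh₀ h
      · exact hf₀ h
    · exact hf₁ h
  obtain ⟨d, hd𝔪, hdBad⟩ := exists_decompose_not_mem_forall_mem 𝒜 h𝔪 hg𝔪 Bad hBad hcore
  set h : A := (DirectSum.decompose 𝒜 (h₀ * f₀ * f₁) d : A) with hh_def
  have hgoodh : ∀ (𝔮 : Ideal A) (h𝔮 : 𝔮.IsPrime), h ∉ 𝔮 → Good 𝔮 h𝔮 := by
    intro 𝔮 h𝔮 hh𝔮
    by_contra hbad
    exact hh𝔮 (hdBad 𝔮 ⟨h𝔮, hbad⟩)
  refine ⟨h, hd𝔪, isHomogeneousElem_coe _, N, U, W, hW, hUhom, ⟨hU𝔪, hli𝔪⟩, ?_, ?_⟩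
  · intro 𝔮 _ hh𝔮 hUq
    exact (hgoodh 𝔮 inferInstance hh𝔮).2.2 hUq
  · intro 𝔮 _ hh𝔮 hd
    exact (hgoodh 𝔮 inferInstance hh𝔮).2.1 hd

end Summit.ResolutionOfSingularities.ResolutionOfSingularities.Cruxes.HypersurfaceCentreConstruction.LocalEngine

end
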